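import Literature.NumberTheory.LFunctions.SelbergMollifierProofs
import HarnessLib

/-!
# Arithmetic of Selberg's coefficients `α_ν` (Titchmarsh §10.9, §10.12–10.13): `α ∗ α = μ`,
# `|α| ∗ |α| ≤ 1`, and the Dirichlet series `∑_{(κ,ρ)=1} α_κ κ^{-w}` squared

Support file for the proof of Titchmarsh's Lemmas 10.12–10.14 (the arithmetic heart of
A. Selberg's positive-proportion theorem, E. C. Titchmarsh, *The Theory of the Riemann
Zeta-Function*, 2nd ed. (1986), §10.9–§10.14). Everything here is PROVED; no named facts.

* §1 `halfChoose k = (-1)^k binom(½,k)`: closed form `∏_{j<k} (j - ½) / k!`, sign (`≤ 0` for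
  `k ≥ 1`), `|halfChoose k| ≤ 1/(4k)` for `k ≥ 2`, and the Vandermonde identity
  `∑_{i+j=k} halfChoose i · halfChoose j = [coefficients of (1-z)] = 1, -1, 0, 0, …`.
* §2 `selbergAlpha` as a multiplicative arithmetic function `alpha` with
  `alpha (p^k) = halfChoose k`; **`alpha * alpha = μ`** (Titchmarsh §10.9:
  `(ζ^{-1/2})² = ζ^{-1}`).
* §3 `|α| ∗ |α| ≤ 1` pointwise (replaces Titchmarsh's majorant `α'_ν` of §10.9/§10.13:
  `(|α|∗|α|)(p^k) = 1, 1, 4|binom(½,k)| ≤ 1`).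
* §4 Restriction to integers coprime to `ρ` and the `ρ`-smooth Möbius function:
  `(α·1_ρ) ∗ (α·1_ρ) = μ·1_ρ`, `(μ·1_ρ) ∗ μ_ρ^{smooth} = μ`.
* §5 Dirichlet series consequences for `1 < re w`:
  `L(α·1_ρ, w)² = L(μ·1_ρ, w)`, `L(μ·1_ρ, w) · L(μ_ρ^{smooth}, w) = ζ(w)⁻¹`,
  `L(μ_ρ^{smooth}, w) = ∏_{p ∣ ρ} (1 - p^{-w})`, whence
  `‖L(α·1_ρ, w)‖² ≤ ‖ζ(w)⁻¹‖ · ∏_{p ∣ ρ} (1 - p^{-re w})⁻¹` — the input to Lemma 10.12 in the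
  form used in `SelbergMollifierLemma1012.lean` (no analytic continuation of `ζ^{-1/2}` is needed).

## References

* [Titchmarsh1986] E. C. Titchmarsh, *The Theory of the Riemann Zeta-Function*, 2nd ed. revised by
  D. R. Heath-Brown, Oxford 1986, §10.9, §10.12, §10.13.
* [Selberg1942] A. Selberg, *On the zeros of Riemann's zeta-function*, Skr. Norske Vid.-Akad. Oslo
  I 1942, no. 10.
-/

noncomputable section

open Complex Real Finset ArithmeticFunction
open scoped ArithmeticFunction.Moebius

namespace Literature.NumberTheory.LFunctions.SelbergMollifier

/-! ## §1 The coefficients `halfChoose k = (-1)^k binom(½, k)` -/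

/-- Closed form: `(-1)^k binom(½,k) = ∏_{j<k} (j - ½) / k!`. [folklore] -/
theorem halfChoose_eq_prod_div (k : ℕ) :
    halfChoose k = (∏ j ∈ Finset.range k, ((j : ℝ) - 1 / 2)) / k.factorial := by
  rw [halfChoose, ring_choose_eq_prod_div', mul_div_assoc']
  congr 1
  rw [show ((-1 : ℝ)) ^ k = ∏ _j ∈ Finset.range k, (-1 : ℝ) by simp, ← Finset.prod_mul_distrib]
  exact Finset.prod_congr rfl fun j _ ↦ by ring

/-- `halfChoose 1 = -½`. [folklore] -/
@[simp] theorem halfChoose_one : halfChoose 1 = -1 / 2 := by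
  rw [halfChoose_eq_prod_div]; norm_num

/-- Recursive closed form: `halfChoose (m+1) = -(½) ∏_{j<m} (j + ½) / (m+1)!`. [folklore] -/
theorem halfChoose_succ (m : ℕ) :
    halfChoose (m + 1) = -(1 / 2) * (∏ j ∈ Finset.range m, ((j : ℝ) + 1 / 2)) / (m + 1).factorial := by
  rw [halfChoose_eq_prod_div, Finset.prod_range_succ']
  congr 1
  push_cast
  ring_nf

/-- The product `∏_{j<m} (j + ½)` is positive. [folklore] -/
theorem prod_add_half_pos (m : ℕ) : 0 < ∏ j ∈ Finset.range m, ((j : ℝ) + 1 / 2) :=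
  Finset.prod_pos fun j _ ↦ by positivity

/-- `halfChoose k ≤ 0` for `k ≥ 1` (the Taylor coefficients of `(1-z)^{1/2}` after the constant
term are negative). [cite: Titchmarsh1986, §10.9] -/
theorem halfChoose_nonpos {k : ℕ} (hk : 1 ≤ k) : halfChoose k ≤ 0 := by
  obtain ⟨m, rfl⟩ : ∃ m, k = m + 1 := ⟨k - 1, by omega⟩
  rw [halfChoose_succ]
  have := prod_add_half_pos m
  have hf : (0 : ℝ) < (m + 1).factorial := by positivity
  apply div_nonpos_of_nonpos_of_nonneg _ hf.le
  nlinarith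

/-- `|halfChoose (m+1)| = ½ ∏_{j<m} (j + ½) / (m+1)!`. [folklore] -/
theorem abs_halfChoose_succ (m : ℕ) :
    |halfChoose (m + 1)| = 1 / 2 * (∏ j ∈ Finset.range m, ((j : ℝ) + 1 / 2)) / (m + 1).factorial := by
  rw [abs_of_nonpos (halfChoose_nonpos (by omega)), halfChoose_succ]
  ring

/-- `∏_{j<m} (j + 3/2) ≤ (m+1)!`. [folklore] -/
theorem prod_add_three_halves_le (m : ℕ) :
    ∏ j ∈ Finset.range m, ((j : ℝ) + 3 / 2) ≤ (m + 1).factorial := by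
  induction m with
  | zero => simp
  | succ m ih =>
    rw [Finset.prod_range_succ, Nat.factorial_succ (m + 1), Nat.cast_mul, mul_comm ((m + 1 + 1 : ℕ) : ℝ)]
    refine mul_le_mul ih ?_ (by positivity) (by positivity)
    push_cast; linarith

/-- **`4 |binom(½, k)| ≤ 1` for `k ≥ 2`** (indeed `|binom(½,k)| ≤ 1/(4k)`). [folklore] -/
theorem four_mul_abs_halfChoose_le {k : ℕ} (hk : 2 ≤ k) : 4 * |halfChoose k| ≤ 1 := by
  obtain ⟨m, rfl⟩ : ∃ m, k = m + 2 := ⟨k - 2, by omega⟩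
  rw [abs_halfChoose_succ (m + 1), Finset.prod_range_succ']
  push_cast
  have h1 : ∏ j ∈ Finset.range m, ((j : ℝ) + 1 + 1 / 2) = ∏ j ∈ Finset.range m, ((j : ℝ) + 3 / 2) :=
    Finset.prod_congr rfl fun j _ ↦ by ring
  rw [h1]
  have h2 := prod_add_three_halves_le m
  have hf : (0 : ℝ) < (m + 1 + 1).factorial := by positivity
  have hfac : ((m + 1 + 1).factorial : ℝ) = (m + 2) * (m + 1).factorial := by
    rw [Nat.factorial_succ (m + 1)]; push_cast; ring
  rw [hfac] at hf ⊢
  rw [show (4 : ℝ) * (1 / 2 * ((∏ j ∈ Finset.range m, ((j : ℝ) + 3 / 2)) * ((0 : ℝ) + 1 / 2)) /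
      ((m + 2) * (m + 1).factorial)) = (∏ j ∈ Finset.range m, ((j : ℝ) + 3 / 2)) /
      ((m + 2) * (m + 1).factorial) by ring]
  rw [div_le_one hf]
  have hm : (1 : ℝ) ≤ m + 2 := by linarith [m.cast_nonneg (α := ℝ)]
  have hf' : (0 : ℝ) < (m + 1).factorial := by positivity
  nlinarith

/-- **Vandermonde for `binom(½, ·)`**: `∑_{i+j=k} halfChoose i · halfChoose j` is the `k`-th
coefficient of `((1-z)^{1/2})² = 1 - z`, i.e. `1, -1, 0, 0, …`. [cite: Titchmarsh1986, §10.9] -/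
theorem sum_antidiagonal_halfChoose (k : ℕ) :
    ∑ ij ∈ antidiagonal k, halfChoose ij.1 * halfChoose ij.2 =
      if k = 0 then 1 else if k = 1 then -1 else 0 := by
  have hV := Ring.add_choose_eq (r := (1 / 2 : ℝ)) (s := 1 / 2) k (Commute.all _ _)
  rw [show (1 / 2 : ℝ) + 1 / 2 = (1 : ℕ) by norm_num, Ring.choose_natCast] at hV
  have hsum : ∑ ij ∈ antidiagonal k, halfChoose ij.1 * halfChoose ij.2 =
      (-1) ^ k * ∑ ij ∈ antidiagonal k, Ring.choose (1 / 2 : ℝ) ij.1 * Ring.choose (1 / 2 : ℝ) ij.2 := by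
    rw [Finset.mul_sum]
    refine Finset.sum_congr rfl fun ij hij ↦ ?_
    rw [Finset.HasAntidiagonal.mem_antidiagonal] at hij
    simp only [halfChoose]
    rw [← hij, pow_add]; ring
  rw [hsum, ← hV]
  rcases Nat.lt_or_ge k 2 with h | h
  · interval_cases k <;> simp
  · rw [Nat.choose_eq_zero_of_lt (by omega)]
    simp only [Nat.cast_zero, mul_zero]
    rw [if_neg (by omega), if_neg (by omega)]

/-- Range form of the Vandermonde identity. [folklore] -/
theorem sum_range_halfChoose (k : ℕ) :
    ∑ e ∈ Finset.range (k + 1), halfChoose e * halfChoose (k - e) =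
      if k = 0 then 1 else if k = 1 then -1 else 0 := by
  rw [← sum_antidiagonal_halfChoose, Finset.Nat.sum_antidiagonal_eq_sum_range_succ_mk]

/-! ## §2 `α` as a multiplicative arithmetic function; `α ∗ α = μ` -/

/-- `α` is multiplicative on coprime arguments. [cite: Titchmarsh1986, §10.9] -/
theorem selbergAlpha_mul_of_coprime {m n : ℕ} (h : m.Coprime n) :
    selbergAlpha (m * n) = selbergAlpha m * selbergAlpha n := by
  rcases eq_or_ne m 0 with rfl | hm
  · simp
  rcases eq_or_ne n 0 with rfl | hn
  · simp
  simp only [selbergAlpha, mul_ne_zero hm hn, hm, hn, if_false]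
  rw [Nat.factorization_mul hm hn, Finsupp.prod_add_index_of_disjoint]
  rw [Nat.support_factorization, Nat.support_factorization]
  exact h.disjoint_primeFactors

/-- `α(p^k) = (-1)^k binom(½, k)`. [cite: Titchmarsh1986, §10.9] -/
theorem selbergAlpha_prime_pow {p : ℕ} (hp : p.Prime) (k : ℕ) :
    selbergAlpha (p ^ k) = halfChoose k := by
  simp only [selbergAlpha, pow_ne_zero k hp.ne_zero, if_false, hp.factorization_pow]
  rw [Finsupp.prod_single_index]
  exact halfChoose_zero

/-- Selberg's `α` as a real arithmetic function. [cite: Titchmarsh1986, §10.9] -/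
def alpha : ArithmeticFunction ℝ := ⟨selbergAlpha, selbergAlpha_zero⟩

/-- `alpha n = α_n`. [folklore] -/
@[simp] theorem alpha_apply (n : ℕ) : alpha n = selbergAlpha n := rfl

/-- `α` is multiplicative. [cite: Titchmarsh1986, §10.9] -/
theorem isMultiplicative_alpha : alpha.IsMultiplicative :=
  ⟨selbergAlpha_one, fun h ↦ selbergAlpha_mul_of_coprime h⟩

/-- Convolution of two functions at a prime power, as a range sum. [folklore] -/
theorem mul_apply_prime_pow {f g : ArithmeticFunction ℝ} {p : ℕ} (hp : p.Prime) (k : ℕ) :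
    (f * g) (p ^ k) = ∑ e ∈ Finset.range (k + 1), f (p ^ e) * g (p ^ (k - e)) := by
  rw [ArithmeticFunction.mul_apply, Nat.sum_divisorsAntidiagonal (fun i j ↦ f i * g j),
    Nat.divisors_prime_pow hp k, Finset.sum_map]
  refine Finset.sum_congr rfl fun e he ↦ ?_
  simp only [Function.Embedding.coeFn_mk]
  rw [Finset.mem_range] at he
  rw [Nat.pow_div (by omega) hp.pos]

/-- **`α ∗ α = μ`**: the Dirichlet square of the coefficients of `ζ(s)^{-1/2}` is the Möbius
function (`(ζ^{-1/2})² = ζ^{-1}`). [cite: Titchmarsh1986, §10.9] -/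
theorem alpha_mul_alpha : alpha * alpha = (μ : ArithmeticFunction ℝ) := by
  have hl : (alpha * alpha).IsMultiplicative := isMultiplicative_alpha.mul isMultiplicative_alpha
  have hr : (μ : ArithmeticFunction ℝ).IsMultiplicative := isMultiplicative_moebius.intCast
  refine (IsMultiplicative.eq_iff_eq_on_prime_powers _ hl _ hr).mpr fun p k hp ↦ ?_
  rw [mul_apply_prime_pow hp, ArithmeticFunction.intCoe_apply]
  simp only [alpha_apply, selbergAlpha_prime_pow hp]
  rw [sum_range_halfChoose]
  rcases Nat.lt_or_ge k 2 with h | h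
  · interval_cases k
    · simp
    · simp [ArithmeticFunction.moebius_apply_prime hp]
  · rw [if_neg (by omega), if_neg (by omega), ArithmeticFunction.moebius_apply_prime_pow hp (by omega),
      if_neg (by omega)]
    simp

/-! ## §3 `|α| ∗ |α| ≤ 1` -/

/-- `|α|` as an arithmetic function. [folklore] -/
def absAlpha : ArithmeticFunction ℝ := ⟨fun n ↦ |selbergAlpha n|, by simp⟩

/-- `absAlpha n = |α_n|`. [folklore] -/
@[simp] theorem absAlpha_apply (n : ℕ) : absAlpha n = |selbergAlpha n| := rfl

/-- `|α|` is multiplicative. [folklore] -/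
theorem isMultiplicative_absAlpha : absAlpha.IsMultiplicative :=
  ⟨by simp, fun h ↦ by simp [selbergAlpha_mul_of_coprime h, abs_mul]⟩

/-- `∑_{e ≤ k} |halfChoose e| |halfChoose (k-e)| ≤ 1`: for `k ≥ 2` the sum equals
`4|binom(½,k)|` by the Vandermonde identity and the sign pattern. [folklore] -/
theorem sum_range_abs_halfChoose_le_one (k : ℕ) :
    ∑ e ∈ Finset.range (k + 1), |halfChoose e| * |halfChoose (k - e)| ≤ 1 := by
  rcases Nat.lt_or_ge k 2 with h | h
  · interval_cases k
    · simp
    · norm_num [Finset.sum_range_succ]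
  obtain ⟨m, rfl⟩ : ∃ m, k = m + 2 := ⟨k - 2, by omega⟩
  have hV := sum_range_halfChoose (m + 2)
  rw [if_neg (by omega), if_neg (by omega)] at hV
  -- peel off `e = 0` and `e = m + 2` in both sums
  rw [Finset.sum_range_succ, Finset.sum_range_succ'] at hV ⊢
  have hmid : ∑ e ∈ Finset.range (m + 1), |halfChoose (e + 1)| * |halfChoose (m + 2 - (e + 1))| =
      ∑ e ∈ Finset.range (m + 1), halfChoose (e + 1) * halfChoose (m + 2 - (e + 1)) := by
    refine Finset.sum_congr rfl fun e he ↦ ?_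
    rw [Finset.mem_range] at he
    rw [abs_of_nonpos (halfChoose_nonpos (by omega)), abs_of_nonpos (halfChoose_nonpos (by omega))]
    ring
  rw [hmid]
  simp only [Nat.sub_self, halfChoose_zero, Nat.sub_zero, abs_one, one_mul, mul_one] at hV ⊢
  have hk : |halfChoose (m + 2)| = -halfChoose (m + 2) := abs_of_nonpos (halfChoose_nonpos (by omega))
  have h4 := four_mul_abs_halfChoose_le (k := m + 2) (by omega)
  linarith

/-- `(|α| ∗ |α|)(p^k) ≤ 1`. [folklore] -/
theorem absAlpha_mul_absAlpha_prime_pow_le {p : ℕ} (hp : p.Prime) (k : ℕ) :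
    (absAlpha * absAlpha) (p ^ k) ≤ 1 := by
  rw [mul_apply_prime_pow hp]
  simp only [absAlpha_apply, selbergAlpha_prime_pow hp]
  exact sum_range_abs_halfChoose_le_one k

/-- `(|α| ∗ |α|)(n) ≥ 0`. [folklore] -/
theorem absAlpha_mul_absAlpha_nonneg (n : ℕ) : 0 ≤ (absAlpha * absAlpha) n := by
  rw [ArithmeticFunction.mul_apply]
  exact Finset.sum_nonneg fun x _ ↦ by simp only [absAlpha_apply]; positivity

/-- **`|α| ∗ |α| ≤ 1`** pointwise (the substitute for Titchmarsh's `∑_{dd₁=D} α'_d α'_{d₁} = 1`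
with the majorant `α'` of §10.9). [cite: Titchmarsh1986, §10.13] -/
theorem absAlpha_mul_absAlpha_le_one (n : ℕ) : (absAlpha * absAlpha) n ≤ 1 := by
  rcases eq_or_ne n 0 with rfl | hn
  · simp
  have hmult : (absAlpha * absAlpha).IsMultiplicative :=
    isMultiplicative_absAlpha.mul isMultiplicative_absAlpha
  rw [hmult.multiplicative_factorization _ hn]
  refine Finset.prod_le_one (fun p _ ↦ absAlpha_mul_absAlpha_nonneg _) fun p hp ↦ ?_
  rw [Nat.support_factorization] at hp
  exact absAlpha_mul_absAlpha_prime_pow_le (Nat.prime_of_mem_primeFactors hp) _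

/-- Unfolded form: `∑_{dd₁ = n} |α_d| |α_{d₁}| ≤ 1`. [cite: Titchmarsh1986, §10.13] -/
theorem sum_divisorsAntidiagonal_abs_alpha_le_one (n : ℕ) :
    ∑ x ∈ n.divisorsAntidiagonal, |selbergAlpha x.1| * |selbergAlpha x.2| ≤ 1 := by
  have := absAlpha_mul_absAlpha_le_one n
  rwa [ArithmeticFunction.mul_apply] at this

/-! ## §4 Coprime restriction and the `ρ`-smooth Möbius function -/

/-- The indicator of the integers coprime to `ρ` (with value `0` at `0`), as a complex arithmetic
function. [folklore] -/
def copInd (ρ : ℕ) : ArithmeticFunction ℂ :=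
  ⟨fun n ↦ if n = 0 then 0 else if n.Coprime ρ then 1 else 0, rfl⟩

/-- Values of `copInd`. [folklore] -/
theorem copInd_apply (ρ n : ℕ) :
    copInd ρ n = if n = 0 then 0 else if n.Coprime ρ then 1 else 0 := rfl

/-- `copInd ρ n = 1` for `n ≠ 0` coprime to `ρ`. [folklore] -/
theorem copInd_of_coprime {ρ n : ℕ} (hn : n ≠ 0) (h : n.Coprime ρ) : copInd ρ n = 1 := by
  simp [copInd_apply, hn, h]

/-- `copInd ρ n = 0` for `n` not coprime to `ρ`. [folklore] -/
theorem copInd_of_not_coprime {ρ n : ℕ} (h : ¬ n.Coprime ρ) : copInd ρ n = 0 := by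
  simp [copInd_apply, h]

/-- `copInd` is completely multiplicative away from `0`. [folklore] -/
theorem copInd_mul {ρ m n : ℕ} (hm : m ≠ 0) (hn : n ≠ 0) :
    copInd ρ (m * n) = copInd ρ m * copInd ρ n := by
  simp only [copInd_apply, mul_ne_zero hm hn, hm, hn, if_false]
  by_cases h1 : m.Coprime ρ
  · by_cases h2 : n.Coprime ρ
    · rw [if_pos (Nat.coprime_mul_iff_left.mpr ⟨h1, h2⟩), if_pos h1, if_pos h2, one_mul]
    · rw [if_neg (fun h ↦ h2 (Nat.coprime_mul_iff_left.mp h).2), if_neg h2, mul_zero]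
  · rw [if_neg (fun h ↦ h1 (Nat.coprime_mul_iff_left.mp h).1), if_neg h1, zero_mul]

/-- `copInd` is multiplicative. [folklore] -/
theorem isMultiplicative_copInd (ρ : ℕ) : (copInd ρ).IsMultiplicative := by
  refine ⟨by simp [copInd_apply], fun {m n} hmn ↦ ?_⟩
  rcases eq_or_ne m 0 with rfl | hm
  · simp [copInd_apply]
  rcases eq_or_ne n 0 with rfl | hn
  · simp [copInd_apply]
  exact copInd_mul hm hn

/-- Restricting both factors of a Dirichlet convolution to integers coprime to `ρ` restricts the
convolution: `(f·1_ρ) ∗ (g·1_ρ) = (f ∗ g)·1_ρ`. [folklore] -/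
theorem pmul_copInd_mul_pmul_copInd (f g : ArithmeticFunction ℂ) (ρ : ℕ) :
    f.pmul (copInd ρ) * g.pmul (copInd ρ) = (f * g).pmul (copInd ρ) := by
  ext n
  simp only [ArithmeticFunction.mul_apply, ArithmeticFunction.pmul_apply, Finset.sum_mul]
  refine Finset.sum_congr rfl fun x hx ↦ ?_
  rw [Nat.mem_divisorsAntidiagonal] at hx
  obtain ⟨hxn, hn⟩ := hx
  have hx1 : x.1 ≠ 0 := by rintro h; simp [h] at hxn; exact hn hxn.symm
  have hx2 : x.2 ≠ 0 := by rintro h; simp [h] at hxn; exact hn hxn.symm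
  rw [← hxn, copInd_mul hx1 hx2]
  ring

/-- Selberg's `α` as a complex arithmetic function. [folklore] -/
def alphaC : ArithmeticFunction ℂ := ⟨fun n ↦ (selbergAlpha n : ℂ), by simp⟩

/-- `alphaC n = α_n`. [folklore] -/
@[simp] theorem alphaC_apply (n : ℕ) : alphaC n = (selbergAlpha n : ℂ) := rfl

/-- `alphaC ∗ alphaC = μ` (complex form of `alpha_mul_alpha`). [cite: Titchmarsh1986, §10.9] -/
theorem alphaC_mul_alphaC : alphaC * alphaC = (μ : ArithmeticFunction ℂ) := by
  ext n
  have h := congrArg (fun F : ArithmeticFunction ℝ ↦ ((F n : ℝ) : ℂ)) alpha_mul_alpha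
  simp only [ArithmeticFunction.mul_apply, ArithmeticFunction.intCoe_apply] at h ⊢
  push_cast at h
  simpa using h

/-- `α` restricted to the integers coprime to `ρ`: `n ↦ α_n 1_{(n,ρ)=1}`. [cite: Titchmarsh1986, §10.12] -/
def alphaCop (ρ : ℕ) : ArithmeticFunction ℂ := alphaC.pmul (copInd ρ)

/-- `μ` restricted to the integers coprime to `ρ`. [folklore] -/
def muCop (ρ : ℕ) : ArithmeticFunction ℂ := (μ : ArithmeticFunction ℂ).pmul (copInd ρ)

/-- **`(α·1_ρ) ∗ (α·1_ρ) = μ·1_ρ`.** [cite: Titchmarsh1986, §10.12] -/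
theorem alphaCop_mul_alphaCop (ρ : ℕ) : alphaCop ρ * alphaCop ρ = muCop ρ := by
  rw [alphaCop, pmul_copInd_mul_pmul_copInd, alphaC_mul_alphaC, muCop]

/-- The `ρ`-smooth Möbius function `d ↦ μ(d) · [every prime factor of d divides ρ]`.
[folklore] -/
def muSmooth (ρ : ℕ) : ArithmeticFunction ℂ :=
  ⟨fun d ↦ if d.primeFactors ⊆ ρ.primeFactors then ((μ d : ℤ) : ℂ) else 0, by simp⟩

/-- Values of `muSmooth`. [folklore] -/
theorem muSmooth_apply (ρ d : ℕ) :
    muSmooth ρ d = if d.primeFactors ⊆ ρ.primeFactors then ((μ d : ℤ) : ℂ) else 0 := rfl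

/-- `muSmooth ρ` is multiplicative. [folklore] -/
theorem isMultiplicative_muSmooth (ρ : ℕ) : (muSmooth ρ).IsMultiplicative := by
  refine ⟨by simp [muSmooth_apply], fun {m n} hmn ↦ ?_⟩
  rcases eq_or_ne m 0 with rfl | hm
  · simp [muSmooth_apply]
  rcases eq_or_ne n 0 with rfl | hn
  · simp [muSmooth_apply]
  simp only [muSmooth_apply, Nat.primeFactors_mul hm hn, Finset.union_subset_iff,
    isMultiplicative_moebius.map_mul_of_coprime hmn, Int.cast_mul]
  by_cases h1 : m.primeFactors ⊆ ρ.primeFactors <;> by_cases h2 : n.primeFactors ⊆ ρ.primeFactors <;>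
    simp [h1, h2]

/-- `muCop ρ` is multiplicative. [folklore] -/
theorem isMultiplicative_muCop (ρ : ℕ) : (muCop ρ).IsMultiplicative :=
  (isMultiplicative_moebius.intCast (R := ℂ)).pmul (isMultiplicative_copInd ρ)

/-- `alphaCop ρ` is multiplicative. [folklore] -/
theorem isMultiplicative_alphaCop (ρ : ℕ) : (alphaCop ρ).IsMultiplicative := by
  refine IsMultiplicative.pmul ⟨by simp, fun h ↦ ?_⟩ (isMultiplicative_copInd ρ)
  simp [selbergAlpha_mul_of_coprime h]

/-- **`(μ·1_ρ) ∗ μ_ρ^{smooth} = μ`** for `ρ ≠ 0` (checked on prime powers). [folklore] -/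
theorem muCop_mul_muSmooth {ρ : ℕ} (hρ : ρ ≠ 0) : muCop ρ * muSmooth ρ = (μ : ArithmeticFunction ℂ) := by
  have hl := (isMultiplicative_muCop ρ).mul (isMultiplicative_muSmooth ρ)
  have hr : (μ : ArithmeticFunction ℂ).IsMultiplicative := isMultiplicative_moebius.intCast
  refine (IsMultiplicative.eq_iff_eq_on_prime_powers _ hl _ hr).mpr fun p k hp ↦ ?_
  rw [ArithmeticFunction.mul_apply, Nat.sum_divisorsAntidiagonal (fun i j ↦ muCop ρ i * muSmooth ρ j),
    Nat.divisors_prime_pow hp k, Finset.sum_map, ArithmeticFunction.intCoe_apply]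
  simp only [Function.Embedding.coeFn_mk]
  have hdiv : ∀ e ∈ Finset.range (k + 1), p ^ k / p ^ e = p ^ (k - e) := fun e he ↦ by
    rw [Finset.mem_range] at he; rw [Nat.pow_div (by omega) hp.pos]
  rw [Finset.sum_congr rfl fun e he ↦ by rw [hdiv e he]]
  by_cases hpρ : p ∣ ρ
  · -- only `e = 0` survives in `muCop`
    have hcop : ∀ e, muCop ρ (p ^ e) = if e = 0 then 1 else 0 := by
      intro e
      rcases eq_or_ne e 0 with rfl | he
      · simp [muCop, copInd_apply]
      · have : ¬ (p ^ e).Coprime ρ := by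
          rw [Nat.coprime_pow_left_iff (Nat.pos_of_ne_zero he), Nat.Prime.coprime_iff_not_dvd hp]
          exact fun h ↦ h hpρ
        simp [muCop, copInd_of_not_coprime this, he]
    simp only [hcop]
    rw [Finset.sum_eq_single 0 (fun e _ he ↦ by simp [he]) (by simp)]
    simp only [if_true, one_mul, Nat.sub_zero, muSmooth_apply]
    have hsub : (p ^ k).primeFactors ⊆ ρ.primeFactors := by
      rcases eq_or_ne k 0 with rfl | hk
      · simp
      · rw [Nat.primeFactors_prime_pow hk hp, Finset.singleton_subset_iff]
        exact Nat.mem_primeFactors.mpr ⟨hp, hpρ, hρ⟩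
    rw [if_pos hsub]
  · -- only `e = k` survives in `muSmooth`
    have hsm : ∀ e, muSmooth ρ (p ^ e) = if e = 0 then 1 else 0 := by
      intro e
      rcases eq_or_ne e 0 with rfl | he
      · simp [muSmooth_apply]
      · have : ¬ (p ^ e).primeFactors ⊆ ρ.primeFactors := by
          rw [Nat.primeFactors_prime_pow he hp, Finset.singleton_subset_iff]
          exact fun h ↦ hpρ (Nat.dvd_of_mem_primeFactors h)
        simp [muSmooth_apply, this, he]
    simp only [hsm]
    rw [Finset.sum_eq_single k (fun e he hek ↦ by
      rw [Finset.mem_range] at he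
      simp [show k - e ≠ 0 by omega]) (by simp)]
    simp only [Nat.sub_self, if_true, mul_one]
    have hcop : (p ^ k).Coprime ρ := by
      rcases eq_or_ne k 0 with rfl | hk
      · simp
      · rw [Nat.coprime_pow_left_iff (Nat.pos_of_ne_zero hk), Nat.Prime.coprime_iff_not_dvd hp]
        exact hpρ
    simp [muCop, copInd_of_coprime (pow_ne_zero k hp.ne_zero) hcop]

/-! ## §5 Dirichlet series: `L(α·1_ρ)² = L(μ·1_ρ)`, `L(μ·1_ρ) L(μ_ρ^{smooth}) = ζ⁻¹`,
`L(μ_ρ^{smooth}) = ∏_{p∣ρ} (1 - p^{-w})` -/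

/-- `|α_n 1_ρ(n)| ≤ 1`. [folklore] -/
theorem norm_alphaCop_le (ρ n : ℕ) : ‖alphaCop ρ n‖ ≤ 1 := by
  simp only [alphaCop, ArithmeticFunction.pmul_apply, alphaC_apply, copInd_apply]
  split_ifs <;> simp [abs_selbergAlpha_le_one]

/-- `|μ(n)| ≤ 1` in `ℂ`. [folklore] -/
theorem norm_moebius_cast_le_one (n : ℕ) : ‖((μ n : ℤ) : ℂ)‖ ≤ 1 := by
  rw [Complex.norm_intCast]
  exact_mod_cast ArithmeticFunction.abs_moebius_le_one

/-- `|μ(n) 1_ρ(n)| ≤ 1`. [folklore] -/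
theorem norm_muCop_le (ρ n : ℕ) : ‖muCop ρ n‖ ≤ 1 := by
  simp only [muCop, ArithmeticFunction.pmul_apply, ArithmeticFunction.intCoe_apply]
  rw [norm_mul]
  have h1 := norm_moebius_cast_le_one n
  have h2 : ‖copInd ρ n‖ ≤ 1 := by simp only [copInd_apply]; split_ifs <;> simp
  calc ‖((μ n : ℤ) : ℂ)‖ * ‖copInd ρ n‖ ≤ 1 * 1 := mul_le_mul h1 h2 (norm_nonneg _) zero_le_one
    _ = 1 := one_mul 1

/-- `|μ_ρ^{smooth}(n)| ≤ 1`. [folklore] -/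
theorem norm_muSmooth_le (ρ n : ℕ) : ‖muSmooth ρ n‖ ≤ 1 := by
  simp only [muSmooth_apply]
  split_ifs
  · exact norm_moebius_cast_le_one n
  · simp

/-- `L(α·1_ρ, w)` converges absolutely for `1 < re w`. [folklore] -/
theorem LSeriesSummable_alphaCop (ρ : ℕ) {w : ℂ} (hw : 1 < w.re) :
    LSeriesSummable (fun n ↦ alphaCop ρ n) w :=
  LSeriesSummable_of_bounded_of_one_lt_re (fun n _ ↦ norm_alphaCop_le ρ n) hw

/-- `L(μ·1_ρ, w)` converges absolutely for `1 < re w`. [folklore] -/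
theorem LSeriesSummable_muCop (ρ : ℕ) {w : ℂ} (hw : 1 < w.re) :
    LSeriesSummable (fun n ↦ muCop ρ n) w :=
  LSeriesSummable_of_bounded_of_one_lt_re (fun n _ ↦ norm_muCop_le ρ n) hw

/-- `L(μ_ρ^{smooth}, w)` converges absolutely for `1 < re w`. [folklore] -/
theorem LSeriesSummable_muSmooth (ρ : ℕ) {w : ℂ} (hw : 1 < w.re) :
    LSeriesSummable (fun n ↦ muSmooth ρ n) w :=
  LSeriesSummable_of_bounded_of_one_lt_re (fun n _ ↦ norm_muSmooth_le ρ n) hw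

/-- **`L(α·1_ρ, w)² = L(μ·1_ρ, w)`** for `1 < re w`. [cite: Titchmarsh1986, §10.12] -/
theorem LSeries_alphaCop_sq (ρ : ℕ) {w : ℂ} (hw : 1 < w.re) :
    LSeries (fun n ↦ alphaCop ρ n) w ^ 2 = LSeries (fun n ↦ muCop ρ n) w := by
  rw [sq, ← LSeries_mul' (LSeriesSummable_alphaCop ρ hw) (LSeriesSummable_alphaCop ρ hw),
    alphaCop_mul_alphaCop]

/-- **`L(μ·1_ρ, w) · L(μ_ρ^{smooth}, w) = ζ(w)⁻¹`** for `1 < re w`, `ρ ≠ 0`. [folklore] -/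
theorem LSeries_muCop_mul_muSmooth {ρ : ℕ} (hρ : ρ ≠ 0) {w : ℂ} (hw : 1 < w.re) :
    LSeries (fun n ↦ muCop ρ n) w * LSeries (fun n ↦ muSmooth ρ n) w = (riemannZeta w)⁻¹ := by
  rw [← LSeries_mul' (LSeriesSummable_muCop ρ hw) (LSeriesSummable_muSmooth ρ hw),
    muCop_mul_muSmooth hρ]
  have h := LSeries_one_mul_Lseries_moebius hw
  rw [LSeries_one_eq_riemannZeta hw] at h
  have hz : riemannZeta w ≠ 0 := riemannZeta_ne_zero_of_one_lt_re hw
  simp only [ArithmeticFunction.intCoe_apply]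
  field_simp
  linear_combination h

/-- The multiplicative function `n ↦ μ_ρ^{smooth}(n) n^{-w}` is supported on `ρ`-factored numbers,
and on them equals `μ(n) n^{-w}`. [folklore] -/
theorem muSmooth_term_eq (ρ : ℕ) (w : ℂ) (n : ℕ) :
    LSeries.term (fun n ↦ muSmooth ρ n) w n =
      if n ∈ Nat.factoredNumbers ρ.primeFactors then ((μ n : ℤ) : ℂ) / (n : ℂ) ^ w else 0 := by
  rw [LSeries.term_def, muSmooth_apply]
  rcases eq_or_ne n 0 with rfl | hn
  · simp [Nat.mem_factoredNumbers_iff_primeFactors_subset]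
  · simp only [hn, if_false, Nat.mem_factoredNumbers_iff_primeFactors_subset, ne_eq, not_false_eq_true,
      true_and]
    split_ifs <;> simp

/-- **`L(μ_ρ^{smooth}, w) = ∏_{p ∣ ρ} (1 - p^{-w})`** for every `w` (a finite Euler product over the
prime factors of `ρ`; only the finitely many squarefree `ρ`-smooth `n` contribute). [folklore] -/
theorem LSeries_muSmooth_eq_prod (ρ : ℕ) (w : ℂ) :
    LSeries (fun n ↦ muSmooth ρ n) w = ∏ p ∈ ρ.primeFactors, (1 - (p : ℂ) ^ (-w)) := by
  -- the multiplicative function `f n = μ(n) n^{-w}`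
  set f : ℕ → ℂ := fun n ↦ ((μ n : ℤ) : ℂ) * (n : ℂ) ^ (-w) with hf
  have hf1 : f 1 = 1 := by simp [hf]
  have hfmul : ∀ {m n : ℕ}, m.Coprime n → f (m * n) = f m * f n := by
    intro m n hmn
    simp only [hf, isMultiplicative_moebius.map_mul_of_coprime hmn, Int.cast_mul, Nat.cast_mul]
    rw [Complex.natCast_mul_natCast_cpow]
    ring
  have hfp : ∀ {p : ℕ}, p.Prime → Summable fun n : ℕ ↦ ‖f (p ^ n)‖ := by
    intro p hp
    refine summable_of_ne_finset_zero (s := Finset.range 2) fun n hn ↦ ?_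
    rw [Finset.mem_range, not_lt] at hn
    simp [hf, ArithmeticFunction.moebius_apply_prime_pow hp (by omega : n ≠ 0), show n ≠ 1 by omega]
  obtain ⟨-, hsum⟩ := EulerProduct.summable_and_hasSum_factoredNumbers_prod_filter_prime_tsum hf1 hfmul
    hfp ρ.primeFactors
  -- evaluate the local factors: `∑_n f(p^n) = 1 - p^{-w}`
  have hloc : ∀ p ∈ ρ.primeFactors, ∑' n : ℕ, f (p ^ n) = 1 - (p : ℂ) ^ (-w) := by
    intro p hp
    have hp' := Nat.prime_of_mem_primeFactors hp
    rw [tsum_eq_sum (s := Finset.range 2) fun n hn ↦ by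
      rw [Finset.mem_range, not_lt] at hn
      simp [hf, ArithmeticFunction.moebius_apply_prime_pow hp' (by omega : n ≠ 0), show n ≠ 1 by omega]]
    simp [Finset.sum_range_succ, hf, ArithmeticFunction.moebius_apply_prime hp', sub_eq_add_neg]
  have hfilter : ρ.primeFactors.filter Nat.Prime = ρ.primeFactors :=
    Finset.filter_true_of_mem fun p hp ↦ Nat.prime_of_mem_primeFactors hp
  rw [hfilter, Finset.prod_congr rfl hloc] at hsum
  -- the L-series is the same sum, extended by zero
  rw [LSeries]
  have hterm : (fun n ↦ LSeries.term (fun n ↦ muSmooth ρ n) w n) =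
      Set.indicator (Nat.factoredNumbers ρ.primeFactors) f := by
    funext n
    rw [muSmooth_term_eq, Set.indicator_apply]
    simp only [hf, div_eq_mul_inv, Complex.cpow_neg]
  rw [hterm, ← _root_.tsum_subtype]
  exact hsum.tsum_eq

/-- Lower bound for the finite Euler product: `∏_{p∣ρ} (1 - p^{-re w}) ≤ ‖∏_{p∣ρ} (1 - p^{-w})‖` for
`0 < re w`. [folklore] -/
theorem prod_one_sub_rpow_le_norm_prod (ρ : ℕ) {w : ℂ} (hw : 0 < w.re) :
    ∏ p ∈ ρ.primeFactors, (1 - (p : ℝ) ^ (-w.re)) ≤ ‖∏ p ∈ ρ.primeFactors, (1 - (p : ℂ) ^ (-w))‖ := by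
  rw [norm_prod]
  refine Finset.prod_le_prod (fun p hp ↦ ?_) fun p hp ↦ ?_
  · have hp := Nat.prime_of_mem_primeFactors hp
    rw [sub_nonneg]
    exact Real.rpow_le_one_of_one_le_of_nonpos (by exact_mod_cast hp.one_lt.le) (by linarith)
  · have hp := Nat.prime_of_mem_primeFactors hp
    have hn : ‖(p : ℂ) ^ (-w)‖ = (p : ℝ) ^ (-w.re) := by
      rw [Complex.norm_natCast_cpow_of_pos hp.pos]; simp
    calc 1 - (p : ℝ) ^ (-w.re) = ‖(1 : ℂ)‖ - ‖(p : ℂ) ^ (-w)‖ := by rw [hn]; simp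
      _ ≤ ‖1 - (p : ℂ) ^ (-w)‖ := norm_sub_norm_le _ _

/-- The finite Euler product is bounded below by a positive quantity. [folklore] -/
theorem prod_one_sub_rpow_pos (ρ : ℕ) {σ : ℝ} (hσ : 0 < σ) :
    0 < ∏ p ∈ ρ.primeFactors, (1 - (p : ℝ) ^ (-σ)) := by
  refine Finset.prod_pos fun p hp ↦ ?_
  have hp := Nat.prime_of_mem_primeFactors hp
  rw [sub_pos]
  exact Real.rpow_lt_one_of_one_lt_of_neg (by exact_mod_cast hp.one_lt) (by linarith)

/-- **The input to Lemma 10.12**: for `1 < re w` and `ρ ≠ 0`,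
`‖∑_{(κ,ρ)=1} α_κ κ^{-w}‖² ≤ ‖ζ(w)⁻¹‖ · ∏_{p∣ρ} (1 - p^{-re w})⁻¹`. [cite: Titchmarsh1986, §10.12] -/
theorem norm_LSeries_alphaCop_sq_le {ρ : ℕ} (hρ : ρ ≠ 0) {w : ℂ} (hw : 1 < w.re) :
    ‖LSeries (fun n ↦ alphaCop ρ n) w‖ ^ 2 ≤
      ‖(riemannZeta w)⁻¹‖ * (∏ p ∈ ρ.primeFactors, (1 - (p : ℝ) ^ (-w.re)))⁻¹ := by
  have hP := prod_one_sub_rpow_pos ρ (σ := w.re) (by linarith)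
  have h1 : ‖LSeries (fun n ↦ alphaCop ρ n) w‖ ^ 2 = ‖LSeries (fun n ↦ muCop ρ n) w‖ := by
    rw [← norm_pow, LSeries_alphaCop_sq ρ hw]
  have h2 : ‖LSeries (fun n ↦ muCop ρ n) w‖ * ‖LSeries (fun n ↦ muSmooth ρ n) w‖ = ‖(riemannZeta w)⁻¹‖ := by
    rw [← norm_mul, LSeries_muCop_mul_muSmooth hρ hw]
  have h3 : ∏ p ∈ ρ.primeFactors, (1 - (p : ℝ) ^ (-w.re)) ≤ ‖LSeries (fun n ↦ muSmooth ρ n) w‖ := by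
    rw [LSeries_muSmooth_eq_prod ρ w]
    exact prod_one_sub_rpow_le_norm_prod ρ (by linarith)
  rw [h1, le_mul_inv_iff₀ hP, ← h2]
  exact mul_le_mul_of_nonneg_left h3 (norm_nonneg _)

end Literature.NumberTheory.LFunctions.SelbergMollifier
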